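/- Lead `ym-line-cbag-p1` (prover-ym-line-cbag-p1-g7-0), route `ColdBoxAllGroups`, crux `BoxFloorAllGroups` (stmt-QuantumFields-22254):
the EXPLICIT-CEILING form of the proved crux (helper, `--supports stmt-QuantumFields-22254`). -/
import Summits.QuantumFields.YangMills.Theorems.WeakCouplingRatesColdBoxTwoPointFloorWStubBoxKernelVsLattice
import Summits.QuantumFields.YangMills.Theorems.WeakCouplingRatesColdBoxTwoPointFloorStubBoxGaussianWick
import Summits.QuantumFields.YangMills.Theorems.BalabanLadderNTOnePointFloor
import Summits.QuantumFields.YangMills.Theorems.ColdBoxAllGroupsBoxFloorAllGroupsStubBoxGaussianDominationGOfAbs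
import Summits.QuantumFields.YangMills.Theorems.ColdBoxAllGroupsBoxFloorAllGroupsStubBoxDirichletDominationAbsG

/-!
# Crux `BoxFloorAllGroups` with an EXPLICIT, `G`-uniform box-exponent ceiling `θ₀ = 1/100`

The proved crux `BoxFloorAllGroups_proof` (stmt-QuantumFields-22254) and its load-bearing stubs S2 `stub_boxDirichletDominationAbsG`,
S3 `stub_boxGaussianDominationG_of_abs` are `∃ θ₀`-packaged: the registered signatures hide the ceiling, although the proofs use the
numerals `θ₀ = 1/100`, `κ = 9θ` for EVERY compact simple `G` and every faithful unitary lattice representation `r` (only the threshold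
`β₀` depends on `(G, r)`).  An `∃`-witness cannot be recovered from a closed proof, so this file re-runs the same kernel-checked arguments
with the ceiling exposed (bodies adapted verbatim from `Theorems/ColdBoxAllGroupsBoxFloorAllGroupsStubBoxDirichletDominationAbsG.lean`,
`…StubBoxGaussianDominationGOfAbs.lean`, `…BoxFloorAllGroups.lean`; only the binder structure changes — fixed `θ`, `A`):

* `boxDirichletDominationAbsG_explicit` — S2 at a fixed `0 < θ ≤ 1/100`: eventually in `β`, for all `T ≤ H = ⌈β^θ⌉`,
  `|β²·boxPlaqCov r.ρ β H T − (D/4)·boxDirCircSqCov H T| ≤ β^{−9θ}` (`D = dimE r.ρ`);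
* `gaussianDomination_of_abs_dim_at` — S3's scalar reduction at fixed `0 < A < θ`, `κ > 8θ`;
* `boxGaussianDominationG_explicit` — the relative Gaussian domination for all `0 < A < θ ≤ 1/100`;
* `boxTwoPointDomination_allGroups_explicit` — **for every compact simple `G`, every `r`, and ALL `0 < A < θ ≤ 1/100` there is `c > 0` with
  `BoxTwoPointDomination r.ρ A θ c`** (the crux with the universal ceiling `1/100`; `c = c₁²/4`, `c₁` from S4 `stub_boxKernelVsLattice`).

This is the BOX half of the `G`-uniform explicit exponent (`Theorems/ColdBoxAllGroupsXiPowExplicit.lean`).  No sorry; no new definition;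
standard axioms.  NOT the Yang–Mills mass gap: finite-volume weak-coupling covariance floors for one Wilson box (RECORD-label rung level,
R2xi-G `XiPow`); no summit statement is proved by this file.
-/

set_option autoImplicit false

noncomputable section

open MeasureTheory ProbabilityTheory Finset Real Filter Topology Metric
open Literature.Probability.LatticeModels (Site)
open Literature.MathematicalPhysics.QuantumLattice
open Literature.MathematicalPhysics.QuantumFieldTheory
open Literature.MathematicalPhysics.QuantumFieldTheory.LatticeMaxwell
open Literature.MathematicalPhysics.QuantumFieldTheory.AxialGauge
open Summit.QuantumFields.YangMills.Theorems.WeakCouplingRates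
open Summit.QuantumFields.YangMills.Theorems.FreeEnergyLogCoefficient

namespace Summit.QuantumFields.YangMills.Theorems.ColdBoxAllGroups

/-- **S2 with the ceiling exposed — the ABSOLUTE one-scale comparison of the cold-wall box with its temporal-gauge Dirichlet Gaussian,
every compact simple `G`, at a fixed box exponent `0 < θ ≤ 1/100`:** eventually in `β`, for every `T ≤ H = ⌈β^θ⌉`,
`|β²·boxPlaqCov r.ρ β H T − (D/4)·boxDirCircSqCov H T| ≤ β^{−9θ}`, `D = dimE r.ρ`.  (The body of `stub_boxDirichletDominationAbsG`,
verbatim: chart density B5-J, exponent window B9c, link window, conditioning B2, representation B4', deterministic core B9a.) -/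
theorem boxDirichletDominationAbsG_explicit :
    ∀ (G : Type) [Group G] [TopologicalSpace G] [IsTopologicalGroup G] [CompactSpace G],
    IsCompactSimpleLieGroup G →
    letI : MeasurableSpace G := borel G
    haveI : BorelSpace G := ⟨rfl⟩
    ∀ r : LatticeRep G, ∀ θ : ℝ, 0 < θ → θ ≤ 1 / 100 → ∃ β₀ : ℝ, ∀ β : ℝ, β₀ ≤ β →
      ∀ T : ℕ, T ≤ ⌈β ^ θ⌉₊ →
        |β ^ 2 * boxPlaqCov r.ρ β ⌈β ^ θ⌉₊ T - (dimE r.ρ : ℝ) / 4 * boxDirCircSqCov ⌈β ^ θ⌉₊ T| ≤ β ^ (-(9 * θ)) := by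
  intro G _ _ _ _ _
  letI : MeasurableSpace G := borel G
  haveI : BorelSpace G := ⟨rfl⟩
  intro r θ hθ hθ1
  haveI : SecondCountableTopology (Matrix (Fin r.N) (Fin r.N) ℂ) := inferInstanceAs (SecondCountableTopology (Fin r.N → Fin r.N → ℂ))
  haveI : SecondCountableTopology G := (r.continuous.isClosedEmbedding r.injective).isEmbedding.secondCountableTopology
  set ρ := r.ρ with hρdef
  have hρc : Continuous ρ := r.continuous
  have hinj : Function.Injective ρ := r.injective
  have hρu : ∀ g, ρ g ∈ Matrix.unitaryGroup (Fin r.N) ℂ := r.mem_unitary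
  -- the chart density (B5-J)
  obtain ⟨r₂, C₂, cH, hr₂, -, hC₂, hcH, J, hJc, hJb, hJhalf, hdens⟩ :=
    exists_chartMeasureE_restrict_closedBall_eq_withDensity ρ hρc hinj hρu
  -- eventual facts: the exponent window (B9c), the link window (ChartWindowG), the conditioning (B2)
  have hwin5 : 2 * θ + 3 * θ < 1 / 2 := by linarith
  obtain ⟨β₁, hE⟩ := Filter.eventually_atTop.1 ((eventually_oneScale_boundsG r.N (dimE ρ) hθ hθ1 hr₂ hC₂).and
    (eventually_linkWindow_subset_image_expChart ρ hρc hinj hρu (ε := 3 * θ) hθ.le hwin5 one_pos))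
  obtain ⟨β₂, hcondE⟩ := abs_boxPlaqCov_sub_cond_le_of_rep ρ hρc hρu hθ (by linarith : 2 * θ < 3 * θ)
  obtain ⟨β₃, hG0E⟩ := boxState_coldGoodSetG_ne_zero ρ hρc hρu hθ (by linarith : 2 * θ < 3 * θ)
  refine ⟨max β₁ (max β₂ β₃), fun β hβ T hT => ?_⟩
  have hb₁ : β₁ ≤ β := (le_max_left _ _).trans hβ
  have hb₂ : β₂ ≤ β := ((le_max_left _ _).trans (le_max_right _ _)).trans hβ
  have hb₃ : β₃ ≤ β := ((le_max_right _ _).trans (le_max_right _ _)).trans hβ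
  obtain ⟨⟨hβ1, hm4, hmr₂, hmEm, hwin, hp1, hfinal⟩, -, hball⟩ := hE β hb₁
  -- names for the one-scale quantities
  set H : ℕ := ⌈β ^ θ⌉₊ with hHdef
  set η : ℝ := (12 * (H : ℝ) ^ 2 + 2 * H + 1) * (Real.sqrt 2 * Real.sqrt (β ^ (2 * (3 * θ) - 1))) with hηdef
  set m : ℝ := 2 * η with hmdef
  set R : ℝ := β ^ (3 * θ) / (2 * (Real.sqrt (dimE ρ) + 1)) with hRdef
  set p : ℝ := 240 * (dimE ρ : ℝ) * (2 * (H : ℝ) + 1) ^ 4 * Real.exp (-R ^ 2 / 2) with hpdef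
  set ℓ : ℝ := 2 * C₂ * m ^ 2 with hℓdef
  have hβ0 : 0 < β := by linarith
  have hH : 1 ≤ H := by
    have := (one_le_ceil_rpow_and_le (A := θ) hβ1 hθ.le).1
    exact_mod_cast this
  have hη0 : 0 < η := by
    have : 0 < Real.sqrt (β ^ (2 * (3 * θ) - 1)) := Real.sqrt_pos.2 (Real.rpow_pos_of_pos hβ0 _)
    positivity
  have hm0 : 0 < m := by positivity
  have hℓ0 : 0 ≤ ℓ := by positivity
  have hR0 : 0 ≤ R := by positivity
  have hmE4 : Real.sqrt (dimE ρ) * ((12 * (H : ℝ) ^ 2 + 2 * H + 1) * R) / Real.sqrt β ≤ 1 / 4 := hmEm.trans hm4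
  -- the density hypotheses at radius `m`
  have hgpos : ∀ a : EuclideanSpace ℝ (Fin (dimE ρ)), ‖a‖ ≤ m → 0 < J a := fun a ha => by
    linarith [(hJhalf a (ha.trans hmr₂)).1]
  have hg : ∀ a : EuclideanSpace ℝ (Fin (dimE ρ)), ‖a‖ ≤ m → |Real.log (J a)| ≤ ℓ := fun a ha => by
    refine (abs_log_jacobian_le hJb hJhalf a (ha.trans hmr₂)).trans ?_
    rw [hℓdef]
    have : ‖a‖ ^ 2 ≤ m ^ 2 := pow_le_pow_left₀ (norm_nonneg _) ha 2
    nlinarith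
  have hc0 : ENNReal.ofReal cH ≠ 0 := by rw [ENNReal.ofReal_ne_zero_iff]; exact hcH
  have hdensm := hdens m hm0 hmr₂
  -- the two charged events
  have hG0 : boxState ρ β H (coldGoodSetG ρ H β (3 * θ)) ≠ 0 := hG0E β hb₃
  haveI : IsProbabilityMeasure (gaussD H (dimE ρ)) := isProbabilityMeasure_gaussD H (dimE ρ)
  have hSm : MeasurableSet (goodTE ρ H β (3 * θ) ∩ {t | ∀ e, ‖unscaleTE H (dimE ρ) β t e‖ ≤ m}) :=
    (measurableSet_goodTE ρ hρc hinj β (3 * θ)).inter (measurableSet_ball_unscaleTE (dimE ρ) β m)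
  have hpS : (gaussD H (dimE ρ)).real (goodTE ρ H β (3 * θ) ∩ {t | ∀ e, ‖unscaleTE H (dimE ρ) β t e‖ ≤ m})ᶜ ≤ p :=
    gaussD_real_compl_goodTE_inter_ball_le ρ hρc hβ0 hH hR0 hmE4 hmEm hwin
  have hγ : gaussD H (dimE ρ) (goodTE ρ H β (3 * θ) ∩ {t | ∀ e, ‖unscaleTE H (dimE ρ) β t e‖ ≤ m}) ≠ 0 :=
    measure_ne_zero_of_real_compl_lt_one _ hSm (hpS.trans_lt hp1)
  -- the representation (B4') at radius `m = 2η`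
  have hrep : ∀ X : LGConfig 4 G → ℝ, Measurable X → IsZdGaugeInvariant X → (∀ U, 0 ≤ X U) →
      ∫ U, X U ∂((boxState ρ β H)[|coldGoodSetG ρ H β (3 * θ)]) =
        ∫ t, X (cfgTE ρ H β t) ∂(((gaussD H (dimE ρ))[|(goodTE ρ H β (3 * θ) ∩ {t | ∀ e, ‖unscaleTE H (dimE ρ) β t e‖ ≤ m})]).tilted
          ((goodTE ρ H β (3 * θ) ∩ {t | ∀ e, ‖unscaleTE H (dimE ρ) β t e‖ ≤ m}).indicator (tiltWE ρ H J β))) :=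
    fun X hXm hXinv hX0 => integral_cond_boxState_eq_integral_tilted_G' ρ hρc hinj hρu hβ0 hH hm4 hball hJc.measurable hgpos hc0
      ENNReal.ofReal_ne_top hdensm hG0 hγ hXm hXinv hX0
  -- the deterministic core (B9a)
  have hcore := abs_boxPlaqCov_sub_dirCircSqCov_le_coreG ρ hρc hinj hρu (ε := 3 * θ) (m := m) (ℓ := ℓ) (R := R) (p := p) (T := T)
    (c₀ := 24 * (r.N : ℝ) ^ 2 * Real.exp (-(β ^ (3 * θ)))) hJc.measurable hβ1 hH hT hm0.le hm4 hℓ0 hg hR0 hmE4 hmEm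
    hwin le_rfl hp1 hrep (hcondE β hb₂ T)
  -- the final smallness (B9c): monotonicity in the tilt size, then `≤ β^{−9θ}`
  refine hcore.trans (le_trans ?_ hfinal)
  have hτ0 : 0 ≤ 190 * β * m ^ 3 := by positivity
  have hw := tiltSize_le_cardBound H hτ0 hℓ0
  have hexp : Real.exp (2 * ((#(plaquettesTouching (boxEdges 4 (2 * H + 1))) : ℝ) * (190 * β * m ^ 3) +
      (Fintype.card (ColdFreeIdx H) : ℝ) * ℓ)) ≤
      Real.exp (2 * (120 * (2 * (H : ℝ) + 1) ^ 4 * (190 * β * m ^ 3) + 4 * (2 * (H : ℝ) + 1) ^ 4 * ℓ)) :=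
    Real.exp_le_exp.2 (by linarith)
  have hM0 : 0 ≤ 3 * (β ^ (2 * (3 * θ))) ^ 2 := by positivity
  have key := mul_le_mul_of_nonneg_left (sub_le_sub_right hexp 1) hM0
  linarith [key]

/-- **S3's `D`-weighted reduction at FIXED exponents.**  For any function `F β H T` (standing for `β²·boxPlaqCov r.ρ β H T`), any weight
`0 ≤ D`, exponents `0 < A < θ` and `κ > 8θ`: if eventually in `β`, for all `T ≤ ⌈β^θ⌉`, `|F β ⌈β^θ⌉ T − (D/4)·boxDirCircSqCov ⌈β^θ⌉ T| ≤ β^{−κ}`,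
then eventually `|F β ⌈β^θ⌉ ⌈β^A⌉ − (D/4)·boxCircSqCov| ≤ (1/8)·boxCircSqCov` at `T = ⌈β^A⌉`.  (The body of `gaussianDomination_of_abs_dim`,
verbatim; threshold `M = 1 + 80π²(K₁+K₂)(D+1)`.) -/
theorem gaussianDomination_of_abs_dim_at (F : ℝ → ℕ → ℕ → ℝ) {D : ℝ} (hD : 0 ≤ D) {A θ κ : ℝ} (hA : 0 < A) (hAθ : A < θ)
    (hκ : 8 * θ < κ)
    (habs : ∃ β₁ : ℝ, ∀ β : ℝ, β₁ ≤ β →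
      ∀ T : ℕ, T ≤ ⌈β ^ θ⌉₊ → |F β ⌈β ^ θ⌉₊ T - D / 4 * boxDirCircSqCov ⌈β ^ θ⌉₊ T| ≤ β ^ (-κ)) :
    ∃ β₀ : ℝ, ∀ β : ℝ, β₀ ≤ β →
      |F β ⌈β ^ θ⌉₊ ⌈β ^ A⌉₊ - D / 4 * boxCircSqCov ⌈β ^ θ⌉₊ ⌈β ^ A⌉₊| ≤ 1 / 8 * boxCircSqCov ⌈β ^ θ⌉₊ ⌈β ^ A⌉₊ := by
  have hθ : 0 < θ := hA.trans hAθ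
  obtain ⟨β₁, h₁⟩ := habs
  obtain ⟨K₁, hK10, hE1⟩ := exists_boxMaxwellPlaqCov_sub_bound
  obtain ⟨K₂, hK20, hE2⟩ := exists_boxDirichletPlaqCov_sub_bound
  obtain ⟨K_C, hKC0, hC⟩ := exists_curvaturePlaquetteCorr_asymp
  have hθA : 0 < θ - A := by linarith
  have hD1 : 0 < D + 1 := by linarith
  -- constants: kernel errors ≤ C/(40(D+1)), asymptotic error ≤ C₀/2, absolute error ≤ C²/20
  set M : ℝ := 1 + 80 * π ^ 2 * (K₁ + K₂) * (D + 1) with hM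
  have hM0 : 0 ≤ 80 * π ^ 2 * (K₁ + K₂) * (D + 1) := by positivity
  have hM1 : 1 ≤ M := by linarith
  set L : ℝ := 2 * π ^ 2 * K_C + 1 with hL
  have hL0 : 0 ≤ 2 * π ^ 2 * K_C := by positivity
  have hL1 : 1 ≤ L := by linarith
  obtain ⟨β₄, -, h₄⟩ := rpow_neg_mul_pow_le_eventually (A := A) (κ := κ) (by linarith)
    (by positivity : (0 : ℝ) < 1 / (4 * π ^ 4) / 20)
  set β₀ : ℝ := max (max (max 1 ((32 : ℝ) ^ (1 / θ))) (max ((16 * M) ^ (1 / (θ - A))) (L ^ (1 / A)))) (max β₁ β₄)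
  refine ⟨β₀, fun β hβ => ?_⟩
  have hβa : max (max 1 ((32 : ℝ) ^ (1 / θ))) (max ((16 * M) ^ (1 / (θ - A))) (L ^ (1 / A))) ≤ β :=
    (le_max_left _ _).trans hβ
  have hb₁ : β₁ ≤ β := le_trans (le_trans (le_max_left _ _) (le_max_right _ _)) hβ
  have hb₄ : β₄ ≤ β := le_trans (le_trans (le_max_right _ _) (le_max_right _ _)) hβ
  have hβ1 : 1 ≤ β := le_trans (le_trans (le_max_left _ _) (le_max_left _ _)) hβa
  have hβpos : 0 < β := by linarith
  have hθpow : (32 : ℝ) ≤ β ^ θ :=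
    le_rpow_of_root_le (by norm_num) hθ (le_trans (le_trans (le_max_right _ _) (le_max_left _ _)) hβa)
  have hdiff : 16 * M ≤ β ^ (θ - A) :=
    le_rpow_of_root_le (by positivity) hθA (le_trans (le_trans (le_max_left _ _) (le_max_right _ _)) hβa)
  have hApow : L ≤ β ^ A :=
    le_rpow_of_root_le (by positivity) hA (le_trans (le_trans (le_max_right _ _) (le_max_right _ _)) hβa)
  have hA1 : 1 ≤ β ^ A := hL1.trans hApow
  have hsplit : β ^ θ = β ^ (θ - A) * β ^ A := by
    rw [← Real.rpow_add hβpos]; ring_nf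
  set T : ℕ := ⌈β ^ A⌉₊
  set H : ℕ := ⌈β ^ θ⌉₊
  have hT_ge : β ^ A ≤ (T : ℝ) := Nat.le_ceil _
  have hT_lt : (T : ℝ) < β ^ A + 1 := Nat.ceil_lt_add_one (by positivity)
  have hT_le : (T : ℝ) ≤ 2 * β ^ A := by linarith
  have hH_ge : β ^ θ ≤ (H : ℝ) := Nat.le_ceil _
  have hT1 : 1 ≤ T := by
    have : (1 : ℝ) ≤ T := hA1.trans hT_ge
    exact_mod_cast this
  have hT0 : (0 : ℝ) < T := by exact_mod_cast hT1
  have hH32 : (32 : ℝ) ≤ H := hθpow.trans hH_ge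
  have hTH_nat : T ≤ H := Nat.ceil_mono (Real.rpow_le_rpow_of_exponent_le hβ1 hAθ.le)
  have hHT : M * (T : ℝ) ≤ (H : ℝ) / 8 := by
    have h1 : M * (T : ℝ) ≤ M * (2 * β ^ A) := mul_le_mul_of_nonneg_left hT_le (by linarith)
    have h2 : 16 * M * β ^ A ≤ β ^ (θ - A) * β ^ A := mul_le_mul_of_nonneg_right hdiff (by linarith)
    rw [← hsplit] at h2
    linarith
  have hTH : (T : ℝ) ≤ (H : ℝ) / 8 := by
    have : (T : ℝ) ≤ M * T := le_mul_of_one_le_left hT0.le hM1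
    linarith
  -- the curvature number and its lower bound
  set C := @Literature.MathematicalPhysics.QuantumFieldTheory.curvaturePlaquetteCorr 4 (by norm_num) (T : ℤ)
  have hasy := hC T hT1
  have hCT : K_C / (T : ℝ) ^ 5 ≤ (1 / π ^ 2 / (T : ℝ) ^ 4) / 2 := by
    have hLT : L ≤ (T : ℝ) := hApow.trans hT_ge
    have hKT : 2 * π ^ 2 * K_C ≤ (T : ℝ) := by linarith
    have e : (1 / π ^ 2 / (T : ℝ) ^ 4) / 2 = 1 / (2 * π ^ 2) / (T : ℝ) ^ 4 := by field_simp
    rw [e, div_le_div_iff₀ (by positivity) (by positivity)]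
    calc K_C * (T : ℝ) ^ 4 = (2 * π ^ 2 * K_C) * (T : ℝ) ^ 4 * (1 / (2 * π ^ 2)) := by field_simp
      _ ≤ (T : ℝ) * (T : ℝ) ^ 4 * (1 / (2 * π ^ 2)) := by gcongr
      _ = 1 / (2 * π ^ 2) * (T : ℝ) ^ 5 := by ring
  have hClow : (1 / π ^ 2 / (T : ℝ) ^ 4) / 2 ≤ C := by
    rw [abs_le] at hasy; linarith [hasy.1]
  have hC0 : 0 ≤ C := le_trans (by positivity) hClow
  -- the two kernel errors are `≤ C/(40(D+1))`
  have herrK : ∀ {K : ℝ}, 0 ≤ K → K ≤ K₁ + K₂ → K / (H : ℝ) ^ 4 ≤ C / (40 * (D + 1)) := by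
    intro K hK0 hKle
    have hMT : M * (T : ℝ) ≤ H := by linarith
    have hMT4 : (M * (T : ℝ)) ^ 4 ≤ (H : ℝ) ^ 4 := pow_le_pow_left₀ (by positivity) hMT 4
    have hM4 : 80 * π ^ 2 * (D + 1) * K ≤ M ^ 4 := by
      have h3 : M ≤ M ^ 4 := by
        calc M = M ^ 1 := (pow_one M).symm
          _ ≤ M ^ 4 := pow_le_pow_right₀ hM1 (by norm_num)
      have h4 : 80 * π ^ 2 * (D + 1) * K ≤ 80 * π ^ 2 * (D + 1) * (K₁ + K₂) :=
        mul_le_mul_of_nonneg_left hKle (by positivity)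
      have h5 : 80 * π ^ 2 * (D + 1) * (K₁ + K₂) = M - 1 := by rw [hM]; ring
      linarith
    have hstep : K / (H : ℝ) ^ 4 ≤ 1 / (80 * π ^ 2 * (D + 1)) / (T : ℝ) ^ 4 := by
      rw [div_le_div_iff₀ (by positivity) (by positivity)]
      calc K * (T : ℝ) ^ 4 = (80 * π ^ 2 * (D + 1) * K) * (T : ℝ) ^ 4 * (1 / (80 * π ^ 2 * (D + 1))) := by
            field_simp
        _ ≤ M ^ 4 * (T : ℝ) ^ 4 * (1 / (80 * π ^ 2 * (D + 1))) := by gcongr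
        _ = 1 / (80 * π ^ 2 * (D + 1)) * (M * (T : ℝ)) ^ 4 := by ring
        _ ≤ 1 / (80 * π ^ 2 * (D + 1)) * (H : ℝ) ^ 4 := mul_le_mul_of_nonneg_left hMT4 (by positivity)
    have e : 1 / (80 * π ^ 2 * (D + 1)) / (T : ℝ) ^ 4 = ((1 / π ^ 2 / (T : ℝ) ^ 4) / 2) / (40 * (D + 1)) := by
      field_simp; ring
    rw [e] at hstep
    exact hstep.trans (div_le_div_of_nonneg_right hClow (by positivity))
  have h1 : |boxMaxwellPlaqCov H T - C| ≤ C / (40 * (D + 1)) := (hE1 H hH32 T hTH).trans (herrK hK10 (by linarith))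
  have h2 : |boxDirichletPlaqCov H T - C| ≤ C / (40 * (D + 1)) := (hE2 H hH32 T hTH).trans (herrK hK20 (by linarith))
  -- the absolute error is `≤ C²/20`
  have hC2 : 1 / (4 * π ^ 4) / (2 * β ^ A) ^ (8 : ℕ) ≤ C ^ 2 := by
    have hsq := pow_le_pow_left₀ (by positivity) hClow 2
    have hT8 : (T : ℝ) ^ 8 ≤ (2 * β ^ A) ^ (8 : ℕ) := pow_le_pow_left₀ hT0.le hT_le 8
    calc 1 / (4 * π ^ 4) / (2 * β ^ A) ^ (8 : ℕ) ≤ 1 / (4 * π ^ 4) / (T : ℝ) ^ 8 :=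
          div_le_div_of_nonneg_left (by positivity) (by positivity) hT8
      _ = ((1 / π ^ 2 / (T : ℝ) ^ 4) / 2) ^ 2 := by field_simp; ring
      _ ≤ C ^ 2 := hsq
  have hsmall : β ^ (-κ) ≤ C ^ 2 / 20 := by
    have e4 := h₄ β hb₄
    have hden : (0 : ℝ) < (2 * β ^ A) ^ (8 : ℕ) := by positivity
    have h3 : β ^ (-κ) ≤ 1 / (4 * π ^ 4) / 20 / (2 * β ^ A) ^ (8 : ℕ) := by
      rw [le_div_iff₀ hden]; exact e4
    calc β ^ (-κ) ≤ 1 / (4 * π ^ 4) / 20 / (2 * β ^ A) ^ (8 : ℕ) := h3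
      _ = (1 / (4 * π ^ 4) / (2 * β ^ A) ^ (8 : ℕ)) / 20 := by ring
      _ ≤ C ^ 2 / 20 := by linarith [hC2]
  have habsT := (h₁ β hb₁ T hTH_nat).trans hsmall
  -- Wick on both sides and the scalar endgame
  rw [stub_boxGaussianWick]
  set e : ℝ := F β H T - D / 4 * boxDirCircSqCov H T with he
  have hcov : F β H T = D / 4 * (2 * boxDirichletPlaqCov H T ^ 2) + e := by
    rw [he, boxDirCircSqCov_eq_two_mul_sq]; ring
  rw [hcov]
  exact scalar_relative_of_abs_dim hD hC0 h1 h2 habsT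

/-- **The relative Gaussian domination with the ceiling exposed, every compact simple `G`** (S3 ∘ S2 at fixed exponents): for all
`0 < A < θ ≤ 1/100`, eventually in `β`, `|β²·boxPlaqCov r.ρ β ⌈β^θ⌉ ⌈β^A⌉ − (D/4)·boxCircSqCov| ≤ (1/8)·boxCircSqCov`, `D = dimE r.ρ`. -/
theorem boxGaussianDominationG_explicit :
    ∀ (G : Type) [Group G] [TopologicalSpace G] [IsTopologicalGroup G] [CompactSpace G],
    IsCompactSimpleLieGroup G →
    letI : MeasurableSpace G := borel G
    haveI : BorelSpace G := ⟨rfl⟩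
    ∀ r : LatticeRep G, ∀ A θ : ℝ, 0 < A → A < θ → θ ≤ 1 / 100 → ∃ β₀ : ℝ, ∀ β : ℝ, β₀ ≤ β →
      |β ^ 2 * boxPlaqCov r.ρ β ⌈β ^ θ⌉₊ ⌈β ^ A⌉₊ - (dimE r.ρ : ℝ) / 4 * boxCircSqCov ⌈β ^ θ⌉₊ ⌈β ^ A⌉₊| ≤
        1 / 8 * boxCircSqCov ⌈β ^ θ⌉₊ ⌈β ^ A⌉₊ := by
  intro G _ _ _ _ hG
  letI : MeasurableSpace G := borel G
  haveI : BorelSpace G := ⟨rfl⟩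
  intro r A θ hA hAθ hθ1
  have hθ : 0 < θ := hA.trans hAθ
  exact gaussianDomination_of_abs_dim_at (D := (dimE r.ρ : ℝ)) (fun β H T => β ^ 2 * boxPlaqCov r.ρ β H T)
    (Nat.cast_nonneg _) hA hAθ (by linarith : 8 * θ < 9 * θ) (boxDirichletDominationAbsG_explicit G hG r θ hθ hθ1)

/-- **Crux `BoxFloorAllGroups` with the UNIVERSAL ceiling `θ₀ = 1/100`:** for every compact simple `G` (tree sense), every faithful unitary
lattice representation `r`, and all `0 < A < θ ≤ 1/100` there is `c > 0` (`= c₁²/4`, `c₁` from S4 `stub_boxKernelVsLattice`) with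
`BoxTwoPointDomination r.ρ A θ c` — for all large `β`, `β²·boxPlaqCov r.ρ β ⌈β^θ⌉ ⌈β^A⌉ ≥ c·C(⌈β^A⌉)²`.  (The body of `BoxFloorAllGroups_proof`
on top of `boxGaussianDominationG_explicit`; `D ≥ 1` by `dimE_pos_of_isCompactSimpleLieGroup`.)  NOT the Clay mass gap. -/
theorem boxTwoPointDomination_allGroups_explicit :
    ∀ (G : Type) [Group G] [TopologicalSpace G] [IsTopologicalGroup G] [CompactSpace G],
    IsCompactSimpleLieGroup G →
    letI : MeasurableSpace G := borel G
    haveI : BorelSpace G := ⟨rfl⟩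
    ∀ r : LatticeRep G, ∀ A θ : ℝ, 0 < A → A < θ → θ ≤ 1 / 100 → ∃ c : ℝ, 0 < c ∧ BoxTwoPointDomination r.ρ A θ c := by
  intro G _ _ _ _ hG
  letI : MeasurableSpace G := borel G
  haveI : BorelSpace G := ⟨rfl⟩
  intro r A θ hA hAθ hθ
  have hD : (1 : ℝ) ≤ (dimE r.ρ : ℝ) := by
    exact_mod_cast Nat.succ_le_of_lt (Summit.QuantumFields.YangMills.Cruxes.NT.LinkEquipartition.dimE_pos_of_isCompactSimpleLieGroup G r hG)
  obtain ⟨β₀, h₀⟩ := boxGaussianDominationG_explicit G hG r A θ hA hAθ hθ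
  obtain ⟨c₁, hc₁, β₁, h₁⟩ := stub_boxKernelVsLattice A θ hA hAθ
  refine ⟨c₁ ^ 2 / 4, by positivity, max β₀ β₁, fun β hβ => ?_⟩
  have h0 := (abs_le.1 (h₀ β (le_trans (le_max_left _ _) hβ))).1
  have h1 := h₁ β (le_trans (le_max_right _ _) hβ)
  have hW := stub_boxGaussianWick ⌈β ^ θ⌉₊ ⌈β ^ A⌉₊
  set P := boxMaxwellPlaqCov ⌈β ^ θ⌉₊ ⌈β ^ A⌉₊ with hP
  set S := boxCircSqCov ⌈β ^ θ⌉₊ ⌈β ^ A⌉₊ with hS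
  have hS2 : S = 2 * P ^ 2 := hW
  have hPsq : 0 ≤ P ^ 2 := sq_nonneg _
  have h1' : (c₁ * |curvaturePlaquetteCorr (d := 4) (by norm_num) (⌈β ^ A⌉₊ : ℤ)|) ^ 2 ≤ |P| ^ 2 :=
    pow_le_pow_left₀ (by positivity) h1 2
  rw [sq_abs, mul_pow, sq_abs] at h1'
  have hmain : (1 / 4 : ℝ) * P ^ 2 ≤ β ^ 2 * boxPlaqCov r.ρ β ⌈β ^ θ⌉₊ ⌈β ^ A⌉₊ := by
    have : ((dimE r.ρ : ℝ) / 4 - 1 / 8) * S ≤ β ^ 2 * boxPlaqCov r.ρ β ⌈β ^ θ⌉₊ ⌈β ^ A⌉₊ := by linarith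
    rw [hS2] at this
    nlinarith
  calc c₁ ^ 2 / 4 * curvaturePlaquetteCorr (d := 4) (by norm_num) (⌈β ^ A⌉₊ : ℤ) ^ 2
      = (1 / 4 : ℝ) * (c₁ ^ 2 * curvaturePlaquetteCorr (d := 4) (by norm_num) (⌈β ^ A⌉₊ : ℤ) ^ 2) := by ring
    _ ≤ (1 / 4 : ℝ) * P ^ 2 := by gcongr
    _ ≤ _ := hmain

/-- **Instance-binder form of `boxDirichletDominationAbsG_explicit`** (any Borel measurable structure on `G`, by `subst`): the input of the
BULK-side flat covariance expansion. -/
theorem boxDirichletDominationAbsG_explicit' :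
    ∀ (G : Type) [Group G] [TopologicalSpace G] [IsTopologicalGroup G] [CompactSpace G] [MeasurableSpace G] [BorelSpace G],
    IsCompactSimpleLieGroup G → ∀ r : LatticeRep G, ∀ θ : ℝ, 0 < θ → θ ≤ 1 / 100 → ∃ β₀ : ℝ, ∀ β : ℝ, β₀ ≤ β →
      ∀ T : ℕ, T ≤ ⌈β ^ θ⌉₊ →
        |β ^ 2 * boxPlaqCov r.ρ β ⌈β ^ θ⌉₊ T - (dimE r.ρ : ℝ) / 4 * boxDirCircSqCov ⌈β ^ θ⌉₊ T| ≤ β ^ (-(9 * θ)) := by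
  intro G _ _ _ _ mG hBG hG r
  have hm : mG = borel G := @BorelSpace.measurable_eq G _ mG hBG
  subst hm
  letI : MeasurableSpace G := borel G
  exact boxDirichletDominationAbsG_explicit G hG r

/-- **Instance-binder form of `boxTwoPointDomination_allGroups_explicit`** (any Borel measurable structure on `G`, by `subst`). -/
theorem boxTwoPointDomination_allGroups_explicit' :
    ∀ (G : Type) [Group G] [TopologicalSpace G] [IsTopologicalGroup G] [CompactSpace G] [MeasurableSpace G] [BorelSpace G],
    IsCompactSimpleLieGroup G → ∀ r : LatticeRep G, ∀ A θ : ℝ, 0 < A → A < θ → θ ≤ 1 / 100 →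
      ∃ c : ℝ, 0 < c ∧ BoxTwoPointDomination r.ρ A θ c := by
  intro G _ _ _ _ mG hBG hG r
  have hm : mG = borel G := @BorelSpace.measurable_eq G _ mG hBG
  subst hm
  letI : MeasurableSpace G := borel G
  exact boxTwoPointDomination_allGroups_explicit G hG r

end Summit.QuantumFields.YangMills.Theorems.ColdBoxAllGroups

end
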